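/-
PORT (pub-hodgecm2, COR-CM cell) of the stage-1 package file `HodgeCMPerL/HodgeCM/Geometry/WeightVectors.lean`
(pub-hodgecm HOME/lean, bytes of record md5 30422a0ecc51, 146 lines). Declarations VERBATIM; edits: imports rewritten to tree
modules, namespace token `HodgeCM` ↦ `Summit.HodgeConjecture.CorCM`, package `conjRingHomK` ↦ tree `Literature.NumberTheory.Automorphic.cmConjRingHom`
(definitionally equal bodies), linter fixes. Generator: pub-hodgecm2-p1 `work/port/build_kit.py`.
-/
/-
Copyright: pub-hodgecm formalisation cell (harness21, 2026). New file (not vendored).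
-/
import Summits.HodgeConjecture.CorCM.Geometry.Statements
import Summits.HodgeConjecture.CorCM.CM.LefschetzChar2
import Literature.AlgebraicGeometry.Motives.HodgeStructureSemisimple

/-!
# Weight vectors on `A′ = ∏_j A_{(F,Θ_j)}` and the two inputs of the face reduction (Pohlmann's span theorem, product form; one internal reduction anchored in print)

The opaque gen 1–4 stub `FaceReduction` ("rows (ii)–(iv) of the COR-CM table") is refined here into
two statements over the geometric universe `U` — one published theorem, Pohlmann's span theorem in product form (Gao–Ullmo 2025 Thm 3.1 = Pohlmann 1968 Thm 1 for CM algebras; [QW8] L2.2; PROVED here from `ModelAxioms` + M29 + M30 since run 17, `Proofs/PohlmannSpan.lean`) and one internal open input, the unrefereed [QW8] Thm 2.5 sufficiency statement (under adjudication; its one print input is Milne 1999; steps (ii)/(iii)+(v) PROVED from `ModelAxioms` + F1–F7 since run 19, `StubTree/Qw8Geometric.lean`):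

* `PohlmannSpan` — **Pohlmann 1968** (Ann. of Math. 88, Thm 1; [QW8] Lemma 2.2): for a Galois CM field
  `F`, the complexified Hodge classes of `A′` lie in the span of the WEIGHT VECTORS `e_S` of HODGE weights
  `S` (`Summit.HodgeConjecture.CorCM.IsHodgeWeight`: `|S| = 2p` and every Galois translate of `e_S` is of type `(p,p)`).
* `Qw8Sufficiency` — **[QW8] Thm 2.5** (sufficiency) with its §3 ā-bridge and Milne 1999 (Lefschetz
  classes): a weight vector of a Hodge weight whose Lefschetz character `a(e_S)` (`Summit.HodgeConjecture.CorCM.lefChar`) is an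
  integer combination of the characters of `σ₀`-Weil weights on corner products `P(f)` of rank-four faces is
  a complexified algebraic class, provided all `W_F(P(f))` are algebraic.  Its combinatorial core (steps
  (i)–(v)) is machine-checked abstractly in `Summit.HodgeConjecture.CorCM.Prior.Qw8Sufficiency.sufficiency_int`.

The third input, that `a(e_S)` IS such a combination for every Hodge weight (`l:allg` + the corner
dictionary), is PROVED: `Summit.HodgeConjecture.CorCM.lefChar_eq_sum_faces`.  The glue `PohlmannSpan → Qw8Sufficiency →
FaceReduction` is `Summit.HodgeConjecture.CorCM.StubTree.faceReduction_holds` (uses the rationality lemma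
`mem_of_ofRat_mem_baseChange` below).

Weight vectors are typed as JOINT EIGENVECTORS: `x ∈ H^k(A′, ℂ)` has weight `S = (S_j)_j`
(`S_j ⊆ Hom(F, ℂ)`) if every endomorphism `M` of `A′` acting on `H¹` as `a ∈ F` on the `j`-th factor and
trivially on the others (`IsFactorAct`) satisfies `M^* x = (∏_{s ∈ S_j} s(a)) · x`.  In the intended model
(`H^•(A′) = ⋀^• ⊕_j H¹(A_{Θ_j})`, `H¹(A_{Θ_j}) ⊗ ℂ = ⊕_s ℂ e_{j,s}`) these are exactly the multiples of the
Hodge monomial `e_S = ⋀_{(j,s) ∈ S} e_{j,s}` ([QW8] §2 "T-weight vectors"; Pohlmann's `m_S`).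
-/

noncomputable section

open scoped TensorProduct

namespace Summit.HodgeConjecture.CorCM

open Literature.AlgebraicGeometry.Motives (CMType)
open Literature.AlgebraicGeometry.Motives.HodgeStructure (ofRat ofRat_apply)

/-! ### Rationality: `c ⊗ 1 ∈ W ⊗ ℂ ⇒ c ∈ W` -/


namespace Universe

variable (U : Universe)

/-! ### Projections of the iterated product and factor-wise CM actions -/

/-- The projections `pr_j : ∏_{i ≤ n} X_i → X_j` of the left-nested product `prodFin`. -/
def prj : (n : ℕ) → (X : Fin (n + 1) → U.Var) → (j : Fin (n + 1)) → U.Mor (U.prodFin n X) (X j)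
  | 0, X => Fin.lastCases (motive := fun j => U.Mor (X 0) (X j)) (U.idMor (X 0)) (fun i => i.elim0)
  | n + 1, X => Fin.lastCases (motive := fun j => U.Mor (U.prodFin (n + 1) X) (X j)) (U.snd _ _)
      (fun i => U.comp (U.fst _ _) (prj n (fun i => X i.castSucc) i))

/-- `M : A′ → A′` acts on `H¹(A′)` as the CM multiplication by `a ∈ F` on the `j`-th factor and as the
identity on the other factors: `M^* ∘ pr_j^* = pr_j^* ∘ ι_{Θ_j}(a)^*` and `M^* ∘ pr_i^* = pr_i^*` (`i ≠ j`)
on `H¹`.  (In the model: `M = id × ⋯ × ι(a) × ⋯ × id` for `a` in the order `End(A_{Θ_j}) ∩ F ⊇ 𝓞_F`.) -/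
def IsFactorAct (F : CMField) {n : ℕ} (Θ : Fin (n + 1) → CMType F) (j : Fin (n + 1)) (a : F)
    (M : U.Mor (U.cmProd F Θ) (U.cmProd F Θ)) : Prop :=
  U.pull M 1 ∘ₗ U.pull (U.prj n (fun i => U.cmAV F (Θ i)) j) 1 =
      U.pull (U.prj n (fun i => U.cmAV F (Θ i)) j) 1 ∘ₗ ((U.cmAct F (Θ j)).ι a : _ →ₗ[ℚ] _) ∧
    ∀ i, i ≠ j → U.pull M 1 ∘ₗ U.pull (U.prj n (fun i => U.cmAV F (Θ i)) i) 1 =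
      U.pull (U.prj n (fun i => U.cmAV F (Θ i)) i) 1

/-- **Weight vectors** ([QW8] §2 "T-weight vectors"; Pohlmann's Hodge monomials `m_S`): `x ∈ H^k(A′, ℂ)`
has weight `S = (S_j)_j`, `S_j ⊆ Hom(F, ℂ)`, if every factor-wise CM action by `a` on the `j`-th factor
multiplies it by `∏_{s ∈ S_j} s(a)`. -/
def IsWeightVector (F : CMField) {n : ℕ} (Θ : Fin (n + 1) → CMType F)
    (S : Fin (n + 1) → Finset ((F : Type) →+* ℂ)) (k : ℕ) (x : U.CohC (U.cmProd F Θ) k) : Prop :=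
  ∀ (j : Fin (n + 1)) (a : F) (M : U.Mor (U.cmProd F Θ) (U.cmProd F Θ)), U.IsFactorAct F Θ j a M →
    U.pullC M k x = (∏ s ∈ S j, s a) • x

/-- Complexified algebraic classes `Alg^p(X) ⊗ ℂ ⊆ H^{2p}(X, ℂ)`. -/
def algC (X : U.Var) (p : ℕ) : Submodule ℂ (U.CohC X (2 * p)) := (U.alg X p).baseChange ℂ

/-- A rational class whose complexification is a complexified algebraic class is algebraic (tree `HodgeStructure.mem_of_ofRat_mem_baseChange`). -/
theorem mem_alg_of_ofRat_mem_algC {X : U.Var} {p : ℕ} {c : U.Coh X (2 * p)}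
    (hc : (ofRat c : U.CohC X (2 * p)) ∈ U.algC X p) : c ∈ U.alg X p :=
  Literature.AlgebraicGeometry.Motives.HodgeStructure.mem_of_ofRat_mem_baseChange _ hc

/-! ### The two inputs of the face reduction (Pohlmann's span theorem, product form = [QW8] L2.2 = Gao–Ullmo 2025 Thm 3.1 for the CM algebra `E = F^{n+1}`; [QW8] Thm 2.5 + §3: internal, anchored in print by Milne 1999 Cor 4.5) -/

/-- **Pohlmann's span theorem, PRODUCT form** (Pohlmann, Ann. of Math. 88 (1968) 161–180, Thm 1, is the statement for ONE CM abelian variety;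
the product form is [QW8] Lemma 2.2, cf. Hazama, Publ. RIMS 39 (2003) §8, by the same proof — referee A E7; the CM-ALGEBRA form — `E` a product of CM fields with `H¹(A,ℚ)` free of rank 1, which covers `A′` with `E = F^{n+1}` — is stated in print in Milne, arXiv:2010.08857 §1 ¶1.2, attributed there to Pohlmann Thm 1; REFEREED PRINT WITH PROOF: Gao–Ullmo, J. Inst. Math. Jussieu 25 (2025) no. 1, 215–249 = arXiv:2411.12249, Thm 3.1 ‘(Pohlmann)’, for `A` associated with any CM pair `(E,Φ)`, `E` a CM algebra — “Pohlmann states this result when A is simple. The proof remains valid for an arbitrary CM abelian variety A” (loc. cit. p. 9) — so this input is a PUBLISHED THEOREM, cited not formalised (writer gen 8, referee A round 6)): for a Galois CM field `F` and `A′ = ∏_j A_{(F,Θ_j)}`, every rational Hodge class of `A′`, complexified,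
lies in the `ℂ`-span of the weight vectors of HODGE weights (`|S| = 2p`, every Galois translate of type
`(p,p)`).  Stated, since gen 6, only in the range the face reduction uses it: `[F:ℚ] ≥ 6` (referee A, G1).  [Mechanism: `B^p ⊗ ℚ̄` is `Gal(ℚ̄/ℚ)`-stable and `H^{p,p}` is spanned by the monomials `e_S` of
type `(p,p)`; `Gal` permutes the lines `ℚ̄ e_S` through its action on `Hom(F, ℂ)`.] -/
def PohlmannSpan : Prop :=
  ∀ (F : CMField), IsGalois ℚ F → 6 ≤ Module.finrank ℚ F → ∀ (n : ℕ) (Θ : Fin (n + 1) → CMType F) (p : ℕ),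
    (U.hodgeClassesOf (U.cmProd F Θ) p).map ofRat ≤
      (Submodule.span ℂ {x : U.CohC (U.cmProd F Θ) (2 * p) |
          ∃ S : Fin (n + 1) → Finset ((F : Type) →+* ℂ),
            IsHodgeWeight Θ p S ∧ U.IsWeightVector F Θ S (2 * p) x}).restrictScalars ℚ

/-- **[QW8] Thm 2.5 (sufficiency) + §3 (ā-bridge) + Milne 1999** in the universe: let `F` be a Galois CM
field of degree `≥ 6` (gen 6: the range the face reduction uses; referee A, G1) all of whose rank-four face
lines `W_F(P(f))` are algebraic.  If `x` is a weight vector of a Hodge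
weight `S` on `A′ = ∏_j A_{(F,Θ_j)}` and its Lefschetz character `a(e_S) ∈ ⊕_O Asym(O)` is an INTEGER
combination `Σ_i c_i · a(w_i)` of the characters of the `σ₀`-Weil weights `w_i` on the corner products
`P(f_i)` of faces `f_i`, then `x` is a complexified algebraic class.  [Proof sketch ([QW8] (i)–(v), internal, unrefereed; only step (iv) — Milne 1999 — is print; referee A S6): replace
`w_i` by a conjugate where needed, take exterior products (`a` is additive), pair with the Poincaré dual
(`a(w^∨) = −a(w)`), so that `x ⊠ W^∨` has `a = 0`, hence is invariant under the Lefschetz group, hence a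
Lefschetz class (Milne, Duke 96 (1999), Thm 3.2 / Cor 4.5), hence algebraic; push forward.  The combinatorial
core of (i)–(v) is `Summit.HodgeConjecture.CorCM.Prior.Qw8Sufficiency.LefschetzCalculus.sufficiency_int`; the identification of
`a(w_i)` with `lefChar f_i.corner (fun _ ↦ {σ₀})` is the ā-bridge of [QW8] §3.] -/
def Qw8Sufficiency : Prop :=
  ∀ (F : CMField), IsGalois ℚ F → 6 ≤ Module.finrank ℚ F → (∀ f : Face F, U.WeilFaceAlgebraic F f) →
    ∀ (n : ℕ) (Θ : Fin (n + 1) → CMType F) (p : ℕ) (S : Fin (n + 1) → Finset ((F : Type) →+* ℂ))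
      (x : U.CohC (U.cmProd F Θ) (2 * p)),
      IsHodgeWeight Θ p S → U.IsWeightVector F Θ S (2 * p) x →
      (∃ (σ₀ : (F : Type) →+* ℂ) (m : ℕ) (f : Fin m → Face F) (c : Fin m → ℤ),
          lefChar Θ S = ∑ i, c i • lefChar (f i).corner (fun _ => {σ₀})) →
      x ∈ U.algC (U.cmProd F Θ) p

end Universe

end Summit.HodgeConjecture.CorCM

end
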